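/-
Copyright (c) 2026 the pub-hodgecm-mathlib formalisation cell (harness21).  Prover seat hodgecm-mathlib-LH4-p09 (g9), req620 Track A «(D-RAM) FOUR-FRAME» squad
(STAGE-1b, row (2) of the piece `f_{T₊}`, the (β₂) road; dealer∕pen LH4-plan (g13) WORD #102: (β₂-H) owner; statement memo `SIG-beta2H.v1` 8901ac1d of LH4-p04 (g7);
mechanism memo `MECH-beta2H.v1` c3af1df2 of this seat), 2026-09-04.
-/
import Summits.HodgeConjecture.HodgeConjecture.Theorems.F0P3cDyRamConeCellLabelBalance   -- ★ p860765 (this seat): §1 engine `ncard_sep_eq_ncard_sep_[not_]of_…`, §2 `dualGen_mul_left`; brings ★ DEFS leaf `F0P3cDyRamToricCensusDefs`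
import Summits.HodgeConjecture.HodgeConjecture.Theorems.F0P3cDyRamConeWeightHalfSplit    -- ★ (LH4-p11 (g5)) (β) flip units: `isOrd_mul_left_iff_of_fixed_unit`
import Summits.HodgeConjecture.HodgeConjecture.Theorems.F0P3cDyRamNormFibreTransport      -- ★ p860690 (LH4-p04 (g7)) (S-1): `v_mul_norm_sub_le`
import HarnessLib

/-!
# Crux `H413`, line LH4 «(D-RAM) FOUR-FRAME» — STAGE-1b, row (2), the (β₂) road, brick (β₂-H) ENGINE, PART 2: THE TWO CANDIDATE LABEL-REVERSING SYMMETRIES OF A SPECIFIC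
# CONE CELL — the FLIP `Λ ↦ ε • Λ` (`ε·Θε = ξ` a `ρ`-fixed unit) of an axis cell, and the FIBRE SYMMETRY `x ↦ x·ε` of the norm-residue fibre `Sol_{2b}(r)` of a tube cell

Cell `hodgecm-mathlib` (D-0151), FLOOR 0, crux item H413 = `stmt-HodgeConjecture-24833`, route of record `HCCMUnconditional`; squad F0∕P3c∕LH4; lane
`--supports stmt-HodgeConjecture-24833 --as helper` (count-neutral; pays NO tier-0 row).  THEOREMS ONLY (no `def`, no instance, no notation, no `sorry`, default heartbeats).
DATUM-FREE (`K` any field with `Valued K ℤᵐ⁰`, `ρ Θ σ : K →+* K` arbitrary ring maps; no residue field, no `|2|`, no self-duality).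

WHY (mechanism memo `F0/P3c/LH4/LH4-p09/g9/beta2H/MECH-beta2H.v1` c3af1df2, over ★ p860795 `F0P3cDyRamGlueLabelNormBlind`).  (β₂-H) («literal-SPECIFIC cone cells are balanced
half∕half», LH4-p04 (g7) `SIG-beta2H.v1` §1) is, by ★ p860765 §1, the existence of a label-reversing self-equivalence of the cell.  ★ p860795 (M1) shows that an EXACT norm-one
rescaling (`ε·Θε = 1` on an axis cell, `εσε = 1` on a glue fibre) leaves the value set of every vertex UNCHANGED — so the symmetries of ★ p860765 §2 preserve labels and cannot
supply `hrev`.  The two symmetries that CAN are typed here (cell-preservation halves; the label face — `hrev` — is LH4-p13 (g8)'s, the existence of `ε` is the datum's):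
* §1 «FLIP FORM» (axis cells `b = 0`, MECH (M3)): for `ε·Θε = ξ` with `ρξ = ξ`, `|ξ| = 1` — LH4-p11 (g5)'s ★ `ConeWeightHalfSplit` flip units, `ξ` a NON-NORM from `E`
  (★ `exists_flipUnit_of_forall_fixed_fixed_isNorm`), which multiply the PLANE part of the value set by `ξ` — `Λ ↦ ε • Λ` PRESERVES `levelSet ρ Θ α ϖE h j a` and
  `levelSetDep … μ` (`smul_mem_levelSet_iff_of_flip`, `smul_mem_levelSetDep_iff_of_flip`: order clauses through ★ `isOrd_mul_left_iff_of_fixed_unit`, the level through `|ξ| = 1`,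
  the depth clause directly plus `ξ⁻¹ • Λ = Λ` — `smul_eq_self_of_fixed_unit_of_mem_levelSet`), whence the per-cell balance for any label(s) exchanged by `ε •`
  (`ncard_levelSetDep_sep_eq_of_flip_labelReversing`, `ncard_levelSetDep_sep_eq_of_flip_exchange`).  NEAREST PRIOR (cited, not restated): ★ `cell_clauses_map_mulLeft`
  (presented clauses, ten more order∕involution letters, used for the (β) WEIGHT split of (ρ2b′-X)); here the `iff` on the DEFS-leaf sets with three letters.
* §2 «FIBRE SYMMETRY» (tube cells `b ≥ 1`, MECH (M2)(M4)): in the E-letters of ★ T2b's right-hand side `Sol_{2b}(r) = {x : 𝒪∕𝓂^{2b} ∣ ∃ u, mk u = x, |uσu − r| ≤ |ϖ^{2b}|}`, for a unit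
  `w` with `|w| = |σw| = 1` and `|wσw·r − r| ≤ |ϖ^{2b}|` (fibre-preserving; the `r′ = r` case of LH4-p04 (g7)'s ★ p860690 transport), `x ↦ x·mk w` PRESERVES `Sol_{2b}(r)`
  (`mul_mk_mem_normFibre_iff`, via ★ `v_mul_norm_sub_le` and its inverse-unit twin `v_inv_norm_mul_sub_le`) ⇒ half∕half for any label with `lab (x·w) ↔ ¬ lab x` on the fibre
  (`ncard_normFibre_sep_eq_of_mul_labelReversing`, two-label form `ncard_normFibre_sep_eq_of_mul_exchange`).  By (M1)+(M2) the candidate `w` is the non-trivial class of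
  `Sol_{2b}(1)∕E¹` (index two at∕above the conductor: ℚ₂(√2) b = 3: 16 vs 8; ℚ₂(i) b = 2, 3: 8 vs 4, 16 vs 8 — `norm_one_classes.v1`).
HONEST LABEL.  Count-neutral set∕lattice∕residue-ring algebra; nothing printed is asserted; no census law is stated; (β₂) stays a HYPOTHESIS; `HC_CM` is proved only modulo the 7
printed citations (2 remaining named inputs: hLiu418 = `stmt-HodgeConjecture-24832`, h413 = `stmt-HodgeConjecture-24833`) until rung 0 closes.
## References
* [Jacobowitz1962] R. Jacobowitz, *Hermitian forms over local fields*, Amer. J. Math. 84 (1962): §4 (dual lattices, modular components, norm-residue gluing).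
* [Serre1979] J.-P. Serre, *Local Fields*, GTM 67 (1979): Ch. III §6 Prop. 12 (orders of a quadratic extension); Ch. V §2–§3 (norm groups of the unit filtration).
* [Kottwitz1986BaseChangeUnits] R. E. Kottwitz, *Base change for unit elements of Hecke algebras*, Compositio Math. 60 (1986): §1 pp. 240–241.
* [Rogawski1990] J. D. Rogawski, *Automorphic Representations of Unitary Groups in Three Variables*, Ann. of Math. Stud. 123 (1990): §4.9 Prop. 4.9.1 (b) p. 55.
-/

set_option autoImplicit false

namespace Summit.HodgeConjecture.HodgeConjecture.Cruxes.H413.F0P3cDyRamConeCellFlipBalance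

open scoped Pointwise WithZero
open Summit.HodgeConjecture.HodgeConjecture.Cruxes.H413.F0P3cDyRamToricCensusDefs
open Summit.HodgeConjecture.HodgeConjecture.Cruxes.H413.F0P3cDyRamConeCellLabelBalance

/-! ## §1 The FLIP form of the axis-cell symmetry — `Λ ↦ ε • Λ` with `ε·Θε = ξ` a `ρ`-FIXED UNIT (LH4-p11 (g5)'s flip units included)

MECHANISM NOTE (`F0/P3c/LH4/LH4-p09/g9/beta2H/MECH-beta2H.v1` c3af1df2 (M3); ★ p860795 `F0P3cDyRamGlueLabelNormBlind`): an EXACT `Θ`-norm-one `ε` leaves the value set of a vertex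
unchanged, so ★ p860765 §2's exact norm-one symmetry is label-PRESERVING and cannot feed `hrev`; the label-reversing symmetry of an AXIS cell is a flip unit `ε` with `ε·Θε = ξ`, `ξ` a `ρ`-fixed unit that
is a NON-NORM from `E` (★ `F0P3cDyRamConeWeightHalfSplit.exists_flipUnit_of_forall_fixed_fixed_isNorm`), which multiplies the PLANE part of the value set by `ξ`.  This section is
the cell-preservation half for such `ε` (the order clauses through ★ `isOrd_mul_left_iff_of_fixed_unit`; the depth clause directly, using `ξ⁻¹ ∈ 𝒪_j`); nearest prior ★
`cell_clauses_map_mulLeft` (presented clauses, ten more letters) — cited, not restated. -/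

section Flip

variable {K : Type*} [Field K] [Valued K ℤᵐ⁰] {ρ Θ : K →+* K} {α : K}

open Summit.HodgeConjecture.HodgeConjecture.Cruxes.H413.F0P3cDyRamConeWeightHalfSplit (isOrd_mul_left_iff_of_fixed_unit)

omit [Valued K ℤᵐ⁰] in
/-- A flip element is non-zero (`ε·Θε = ξ ≠ 0`). [cite: Jacobowitz1962, §4] -/
theorem ne_zero_of_mul_map_eq {ε ξ : K} (hε : ε * Θ ε = ξ) (hξ0 : ξ ≠ 0) : ε ≠ 0 := fun h0 => by
  rw [h0, zero_mul] at hε; exact hξ0 hε.symm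

omit [Valued K ℤᵐ⁰] in
/-- The inverse flip has `Θ`-norm `ξ⁻¹`. [cite: Jacobowitz1962, §4] -/
theorem inv_mul_map_inv_eq {ε ξ : K} (hε : ε * Θ ε = ξ) : ε⁻¹ * Θ ε⁻¹ = ξ⁻¹ := by
  rw [map_inv₀, ← mul_inv, hε]

/-- **A `ρ`-FIXED UNIT MULTIPLE OF AN ORDER ELEMENT IS AN ORDER ELEMENT** — membership transport for the generator presentation: if every member of `Λ` is `x₀·z` with `z` in the
order of conductor `c`, then so is every member of `Λ` written against `x₀·ξ'⁻¹… `; concretely `IsOrd c (ξ'·z) ↔ IsOrd c z` (★ `isOrd_mul_left_iff_of_fixed_unit`, re-exported in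
the `ξ'⁻¹` form used below). [cite: Serre1979, Ch. III §6 Prop. 12] [cite: Jacobowitz1962, §4] -/
theorem isOrd_inv_mul_iff_of_fixed_unit {ξ' : K} (hρξ : ρ ξ' = ξ') (hξ1 : Valued.v ξ' = 1) (c y : K) :
    IsOrd ρ α c (ξ'⁻¹ * y) ↔ IsOrd ρ α c y :=
  isOrd_mul_left_iff_of_fixed_unit (α := α) (by rw [map_inv₀, hρξ]) (by rw [map_inv₀, hξ1, inv_one]) c y

/-- **`ε • levelSet = levelSet` FOR A FLIP (one direction).**  For `ε·Θε = ξ` with `ρξ = ξ`, `|ξ| = 1`: if `Λ = x₀·𝒪_j ∈ levelSet ρ Θ α ϖE h j a` then `ε • Λ = (ε·x₀)·𝒪_j` is in it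
too — the dual generator becomes `ξ·dualGen(x₀)` (`dualGen_mul_left`) and a `ρ`-fixed unit moves neither the order clauses (★ `isOrd_mul_left_iff_of_fixed_unit`) nor the level.
[cite: Jacobowitz1962, §4] [cite: Serre1979, Ch. III §6 Prop. 12] -/
theorem smul_mem_levelSet_of_mem_of_flip {ε ξ : K} (hε : ε * Θ ε = ξ) (hρξ : ρ ξ = ξ) (hξ1 : Valued.v ξ = 1) (ϖE h : K) (j a : ℕ)
    {Λ : AddSubgroup K} (hΛ : Λ ∈ levelSet ρ Θ α ϖE h j a) : ε • Λ ∈ levelSet ρ Θ α ϖE h j a := by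
  have hξ0 : ξ ≠ 0 := fun h0 => by rw [h0, map_zero] at hξ1; exact zero_ne_one hξ1
  have hε0 : ε ≠ 0 := ne_zero_of_mul_map_eq hε hξ0
  obtain ⟨x₀, hx₀, hmem, hyO, hyprim, hylev⟩ := hΛ
  refine ⟨ε * x₀, mul_ne_zero hε0 hx₀, fun x => ?_, ?_, ?_, ?_⟩
  · rw [AddSubgroup.mem_smul_pointwise_iff_exists]
    constructor
    · rintro ⟨s, hs, rfl⟩
      obtain ⟨z, hz, rfl⟩ := (hmem s).1 hs
      exact ⟨z, hz, by rw [smul_eq_mul, mul_assoc]⟩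
    · rintro ⟨z, hz, rfl⟩
      exact ⟨x₀ * z, (hmem _).2 ⟨z, hz, rfl⟩, by rw [smul_eq_mul, mul_assoc]⟩
  · rw [dualGen_mul_left, hε, isOrd_mul_left_iff_of_fixed_unit (α := α) hρξ hξ1]; exact hyO
  · rw [dualGen_mul_left, hε, mul_div_assoc, isOrd_mul_left_iff_of_fixed_unit (α := α) hρξ hξ1]; exact hyprim
  · rw [dualGen_mul_left, hε, map_mul, hξ1, one_mul, hylev]

/-- **`Λ ↦ ε • Λ` PRESERVES `levelSet ρ Θ α ϖE h j a` FOR A FLIP** (`ε·Θε = ξ`, `ρξ = ξ`, `|ξ| = 1`; iff via the inverse flip `ε⁻¹`, of `Θ`-norm `ξ⁻¹`).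
[cite: Jacobowitz1962, §4] [cite: Serre1979, Ch. III §6 Prop. 12] -/
theorem smul_mem_levelSet_iff_of_flip {ε ξ : K} (hε : ε * Θ ε = ξ) (hρξ : ρ ξ = ξ) (hξ1 : Valued.v ξ = 1) (ϖE h : K) (j a : ℕ) (Λ : AddSubgroup K) :
    ε • Λ ∈ levelSet ρ Θ α ϖE h j a ↔ Λ ∈ levelSet ρ Θ α ϖE h j a := by
  have hξ0 : ξ ≠ 0 := fun h0 => by rw [h0, map_zero] at hξ1; exact zero_ne_one hξ1
  refine ⟨fun hΛ => ?_, smul_mem_levelSet_of_mem_of_flip hε hρξ hξ1 ϖE h j a⟩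
  have h' := smul_mem_levelSet_of_mem_of_flip (ρ := ρ) (α := α) (inv_mul_map_inv_eq hε) (by rw [map_inv₀, hρξ]) (by rw [map_inv₀, hξ1, inv_one]) ϖE h j a hΛ
  rwa [smul_smul, inv_mul_cancel₀ (ne_zero_of_mul_map_eq hε hξ0), one_smul] at h'

/-- **A level-set member is stable under `ρ`-fixed units: `ξ' • Λ = Λ`** (`ρξ' = ξ'`, `|ξ'| = 1`: the unit lies in every order `𝒪_j`). [cite: Serre1979, Ch. III §6 Prop. 12] -/
theorem smul_eq_self_of_fixed_unit_of_mem_levelSet {ξ' : K} (hρξ : ρ ξ' = ξ') (hξ1 : Valued.v ξ' = 1) {ϖE h : K} {j a : ℕ}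
    {Λ : AddSubgroup K} (hΛ : Λ ∈ levelSet ρ Θ α ϖE h j a) : ξ' • Λ = Λ := by
  have hξ0 : ξ' ≠ 0 := fun h0 => by rw [h0, map_zero] at hξ1; exact zero_ne_one hξ1
  obtain ⟨x₀, -, hmem, -, -, -⟩ := hΛ
  ext x
  rw [AddSubgroup.mem_smul_pointwise_iff_exists]
  constructor
  · rintro ⟨s, hs, rfl⟩
    obtain ⟨z, hz, rfl⟩ := (hmem s).1 hs
    refine (hmem _).2 ⟨ξ' * z, (isOrd_mul_left_iff_of_fixed_unit (α := α) hρξ hξ1 _ z).2 hz, ?_⟩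
    rw [smul_eq_mul]; ring
  · intro hx
    obtain ⟨z, hz, rfl⟩ := (hmem x).1 hx
    refine ⟨x₀ * (ξ'⁻¹ * z), (hmem _).2 ⟨ξ'⁻¹ * z, (isOrd_inv_mul_iff_of_fixed_unit (α := α) hρξ hξ1 _ z).2 hz, rfl⟩, ?_⟩
    rw [smul_eq_mul, ← mul_assoc, mul_comm ξ' x₀, mul_assoc, mul_inv_cancel_left₀ hξ0]

/-- **`ε • levelSetDep = levelSetDep` FOR A FLIP (one direction).**  The depth clause: a test vector `b` for `ε • Λ` is `Θε·b` for `Λ`, so `μ·(Θε·b) ∈ Λ`, hence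
`ε·μ·Θε·b = ξ·μ·b ∈ ε • Λ`, and `ε • Λ` is `ξ⁻¹`-stable (a level-set member). [cite: Jacobowitz1962, §4] [cite: Kottwitz1986BaseChangeUnits, §1 pp. 240–241] -/
theorem smul_mem_levelSetDep_of_mem_of_flip {ε ξ : K} (hε : ε * Θ ε = ξ) (hρξ : ρ ξ = ξ) (hξ1 : Valued.v ξ = 1) (ϖE h : K) (j a : ℕ) (μ : K)
    {Λ : AddSubgroup K} (hΛ : Λ ∈ levelSetDep ρ Θ α ϖE h j a μ) : ε • Λ ∈ levelSetDep ρ Θ α ϖE h j a μ := by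
  have hξ0 : ξ ≠ 0 := fun h0 => by rw [h0, map_zero] at hξ1; exact zero_ne_one hξ1
  have hεΛ : ε • Λ ∈ levelSet ρ Θ α ϖE h j a := smul_mem_levelSet_of_mem_of_flip hε hρξ hξ1 ϖE h j a hΛ.1
  refine ⟨hεΛ, fun b hb => ?_⟩
  have hb' : ∀ x ∈ Λ, Valued.v (h * Θ x * (Θ ε * b) + ρ (h * Θ x * (Θ ε * b))) ≤ 1 := fun x hx => by
    have hx' := hb (ε • x) (AddSubgroup.smul_mem_pointwise_smul x ε Λ hx)
    rwa [smul_eq_mul, map_mul, show h * (Θ ε * Θ x) * b = h * Θ x * (Θ ε * b) by ring] at hx'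
  have hμ : μ * (Θ ε * b) ∈ Λ := hΛ.2 (Θ ε * b) hb'
  have hεμ : ε • (μ * (Θ ε * b)) = ξ * (μ * b) := by
    rw [smul_eq_mul, show ε * (μ * (Θ ε * b)) = (ε * Θ ε) * (μ * b) by ring, hε]
  have hξμb : ξ * (μ * b) ∈ ε • Λ := by rw [← hεμ]; exact AddSubgroup.smul_mem_pointwise_smul _ ε Λ hμ
  -- `ε • Λ` is `ξ⁻¹`-stable, being a level-set member
  have hstab : ξ⁻¹ • (ε • Λ) = ε • Λ :=
    smul_eq_self_of_fixed_unit_of_mem_levelSet (ρ := ρ) (Θ := Θ) (α := α) (by rw [map_inv₀, hρξ]) (by rw [map_inv₀, hξ1, inv_one]) hεΛ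
  have : ξ⁻¹ • (ξ * (μ * b)) ∈ ξ⁻¹ • (ε • Λ) := AddSubgroup.smul_mem_pointwise_smul _ ξ⁻¹ _ hξμb
  rwa [hstab, smul_eq_mul, inv_mul_cancel_left₀ hξ0] at this

/-- **`Λ ↦ ε • Λ` PRESERVES `levelSetDep ρ Θ α ϖE h j a μ` FOR A FLIP** (`ε·Θε = ξ`, `ρξ = ξ`, `|ξ| = 1`; iff).  This is the (M3) symmetry of the AXIS cells `b = 0` (glue class
irrelevant there); for `b ≥ 1` a flip with `ξ` a non-norm moves the glue class off the cell's (★ `glueUnit_mul_left`), so it is not used on tube cells.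
[cite: Jacobowitz1962, §4] [cite: Kottwitz1986BaseChangeUnits, §1 pp. 240–241] -/
theorem smul_mem_levelSetDep_iff_of_flip {ε ξ : K} (hε : ε * Θ ε = ξ) (hρξ : ρ ξ = ξ) (hξ1 : Valued.v ξ = 1) (ϖE h : K) (j a : ℕ) (μ : K) (Λ : AddSubgroup K) :
    ε • Λ ∈ levelSetDep ρ Θ α ϖE h j a μ ↔ Λ ∈ levelSetDep ρ Θ α ϖE h j a μ := by
  have hξ0 : ξ ≠ 0 := fun h0 => by rw [h0, map_zero] at hξ1; exact zero_ne_one hξ1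
  refine ⟨fun hΛ => ?_, smul_mem_levelSetDep_of_mem_of_flip hε hρξ hξ1 ϖE h j a μ⟩
  have h' := smul_mem_levelSetDep_of_mem_of_flip (ρ := ρ) (α := α) (inv_mul_map_inv_eq hε) (by rw [map_inv₀, hρξ]) (by rw [map_inv₀, hξ1, inv_one]) ϖE h j a μ hΛ
  rwa [smul_smul, inv_mul_cancel₀ (ne_zero_of_mul_map_eq hε hξ0), one_smul] at h'

/-- **(M3) BALANCE OF A DEPTH CELL FROM A LABEL-REVERSING FLIP.**  For a flip `ε` (`ε·Θε = ξ`, `ρξ = ξ`, `|ξ| = 1`) and a label with `lab (ε • Λ) ↔ ¬ lab Λ` on the cell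
`levelSetDep ρ Θ α ϖE h j a μ`: `#{Λ ∈ cell ∣ lab Λ} = #{Λ ∈ cell ∣ ¬ lab Λ}`. [cite: Rogawski1990, §4.9 Prop. 4.9.1 (b) p. 55] [cite: Kottwitz1986BaseChangeUnits, §1 pp. 240–241] -/
theorem ncard_levelSetDep_sep_eq_of_flip_labelReversing {ε ξ : K} (hε : ε * Θ ε = ξ) (hρξ : ρ ξ = ξ) (hξ1 : Valued.v ξ = 1) (ϖE h : K) (j a : ℕ) (μ : K)
    (lab : AddSubgroup K → Prop) (hrev : ∀ Λ ∈ levelSetDep ρ Θ α ϖE h j a μ, lab (ε • Λ) ↔ ¬ lab Λ) :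
    {Λ ∈ levelSetDep ρ Θ α ϖE h j a μ | lab Λ}.ncard = {Λ ∈ levelSetDep ρ Θ α ϖE h j a μ | ¬ lab Λ}.ncard := by
  have hξ0 : ξ ≠ 0 := fun h0 => by rw [h0, map_zero] at hξ1; exact zero_ne_one hξ1
  have hε0 : ε ≠ 0 := ne_zero_of_mul_map_eq hε hξ0
  let τ : AddSubgroup K ≃ AddSubgroup K :=
    ⟨fun Λ => ε • Λ, fun Λ => ε⁻¹ • Λ, fun Λ => by simp only [smul_smul, inv_mul_cancel₀ hε0, one_smul],
      fun Λ => by simp only [smul_smul, mul_inv_cancel₀ hε0, one_smul]⟩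
  exact ncard_sep_eq_ncard_sep_not_of_labelReversing _ τ (fun Λ => smul_mem_levelSetDep_iff_of_flip hε hρξ hξ1 ϖE h j a μ Λ) lab hrev

/-- **(M3) TWO-LABEL BALANCE OF A DEPTH CELL UNDER A FLIP** (`P Λ → Q (ε • Λ)`, `Q Λ → P (ε⁻¹ • Λ)` on the cell ⇒ `#{P} = #{Q}`; for (β₂-H): `P = +`, `Q = −′`).
[cite: Rogawski1990, §4.9 Prop. 4.9.1 (b) p. 55] [cite: Kottwitz1986BaseChangeUnits, §1 pp. 240–241] -/
theorem ncard_levelSetDep_sep_eq_of_flip_exchange {ε ξ : K} (hε : ε * Θ ε = ξ) (hρξ : ρ ξ = ξ) (hξ1 : Valued.v ξ = 1) (ϖE h : K) (j a : ℕ) (μ : K)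
    (P Q : AddSubgroup K → Prop) (hPQ : ∀ Λ ∈ levelSetDep ρ Θ α ϖE h j a μ, P Λ → Q (ε • Λ)) (hQP : ∀ Λ ∈ levelSetDep ρ Θ α ϖE h j a μ, Q Λ → P (ε⁻¹ • Λ)) :
    {Λ ∈ levelSetDep ρ Θ α ϖE h j a μ | P Λ}.ncard = {Λ ∈ levelSetDep ρ Θ α ϖE h j a μ | Q Λ}.ncard := by
  have hξ0 : ξ ≠ 0 := fun h0 => by rw [h0, map_zero] at hξ1; exact zero_ne_one hξ1
  have hε0 : ε ≠ 0 := ne_zero_of_mul_map_eq hε hξ0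
  let τ : AddSubgroup K ≃ AddSubgroup K :=
    ⟨fun Λ => ε • Λ, fun Λ => ε⁻¹ • Λ, fun Λ => by simp only [smul_smul, inv_mul_cancel₀ hε0, one_smul],
      fun Λ => by simp only [smul_smul, mul_inv_cancel₀ hε0, one_smul]⟩
  exact ncard_sep_eq_ncard_sep_of_equiv _ τ (fun Λ => smul_mem_levelSetDep_iff_of_flip hε hρξ hξ1 ϖE h j a μ Λ) P Q hPQ hQP

end Flip

/-! ## §2 The TUBE-CELL FIBRE SYMMETRY `x ↦ x·ε` of the norm-residue fibre `Sol_{2b}(r)` (E-letters of ★ T2b's right-hand side)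

MECHANISM NOTE (MECH-beta2H (M1)(M2)(M4)): on a tube cell `b ≥ 1` the fibre over `Λ` is `Sol_{2b}(r) = {x : 𝒪∕𝓂^{2b} ∣ ∃ u, mk u = x, |uσu − r| ≤ |ϖ^{2b}|}`; multiplication by a unit `ε`
with `|εσε·r − r| ≤ |ϖ^{2b}|` (fibre-preserving; LH4-p04 (g7)'s ★ p860690 transport at `r′ = r`) is a PERMUTATION of it, and the label-reversing one is the non-trivial class of
`Sol_{2b}(1)∕E¹` (at∕above the conductor: index two), an exact norm-one `ε` being label-preserving (★ p860795). -/

section Fibre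

open scoped Valued

variable {K : Type*} [Field K] [Valued K ℤᵐ⁰]

open Summit.HodgeConjecture.HodgeConjecture.Cruxes.H413.F0P3cDyRamNormFibreTransport (v_mul_norm_sub_le)

/-- **THE INVERSE UNIT TRANSPORTS THE NORM CONGRUENCE BACK** (the `r′ = r` bookkeeping of ★ p860690): for a unit `w` of `𝒪[K]` with `|w| = |σw| = 1` and `|wσw·r − r| ≤ |m|`,
also `|w⁻¹σw⁻¹·r − r| ≤ |m|`. [cite: Jacobowitz1962, §4] -/
theorem v_inv_norm_mul_sub_le (σ : K →+* K) (w : (𝒪[K])ˣ) {r m : K} (hw1 : Valued.v ((w : 𝒪[K]) : K) = 1) (hσw1 : Valued.v (σ ((w : 𝒪[K]) : K)) = 1)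
    (hz : Valued.v (((w : 𝒪[K]) : K) * σ ((w : 𝒪[K]) : K) * r - r) ≤ Valued.v m) :
    Valued.v (((↑(w⁻¹ : (𝒪[K])ˣ) : 𝒪[K]) : K) * σ (((↑(w⁻¹ : (𝒪[K])ˣ) : 𝒪[K]) : K)) * r - r) ≤ Valued.v m := by
  set y : K := ((↑(w⁻¹ : (𝒪[K])ˣ) : 𝒪[K]) : K) with hy
  have hyz : y * ((w : 𝒪[K]) : K) = 1 := by rw [hy, ← Subring.coe_mul, Units.inv_mul, Subring.coe_one]
  have hσyz : σ y * σ ((w : 𝒪[K]) : K) = 1 := by rw [← map_mul, hyz, map_one]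
  have hy1 : Valued.v y = 1 := by
    have := congrArg Valued.v hyz; rw [map_mul, hw1, mul_one, map_one] at this; exact this
  have hσy1 : Valued.v (σ y) = 1 := by
    have := congrArg Valued.v hσyz; rw [map_mul, hσw1, mul_one, map_one] at this; exact this
  have e : y * σ y * r - r = -(y * σ y) * (((w : 𝒪[K]) : K) * σ ((w : 𝒪[K]) : K) * r - r) := by
    have h1 : y * σ y * (((w : 𝒪[K]) : K) * σ ((w : 𝒪[K]) : K)) = 1 := by
      calc y * σ y * (((w : 𝒪[K]) : K) * σ ((w : 𝒪[K]) : K)) = (y * ((w : 𝒪[K]) : K)) * (σ y * σ ((w : 𝒪[K]) : K)) := by ring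
        _ = 1 := by rw [hyz, hσyz, mul_one]
    calc y * σ y * r - r = y * σ y * r - (y * σ y * (((w : 𝒪[K]) : K) * σ ((w : 𝒪[K]) : K))) * r := by rw [h1, one_mul]
      _ = -(y * σ y) * (((w : 𝒪[K]) : K) * σ ((w : 𝒪[K]) : K) * r - r) := by ring
  rw [e, map_mul, Valuation.map_neg, map_mul, hy1, hσy1, one_mul, one_mul]
  exact hz

/-- **THE FIBRE SYMMETRY `x ↦ x·ε` PRESERVES `Sol_{2b}(r)`** (as a set in `𝒪[K] ⧸ 𝓂[K]^{2b}`; iff): for a unit `w` of `𝒪[K]` with `|w| = |σw| = 1` and `|wσw·r − r| ≤ |ϖ^{2b}|`,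
`x·mk w ∈ Sol_{2b}(r) ↔ x ∈ Sol_{2b}(r)` (★ p860690 `v_mul_norm_sub_le` both ways). [cite: Jacobowitz1962, §4] [cite: Serre1979, Ch. V §2] -/
theorem mul_mk_mem_normFibre_iff (σ : K →+* K) {ϖ : K} (b : ℕ) (r : K) (w : (𝒪[K])ˣ) (hw1 : Valued.v ((w : 𝒪[K]) : K) = 1) (hσw1 : Valued.v (σ ((w : 𝒪[K]) : K)) = 1)
    (hz : Valued.v (((w : 𝒪[K]) : K) * σ ((w : 𝒪[K]) : K) * r - r) ≤ Valued.v (ϖ ^ (2 * b))) (x : 𝒪[K] ⧸ 𝓂[K] ^ (2 * b)) :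
    x * Ideal.Quotient.mk (𝓂[K] ^ (2 * b)) (w : 𝒪[K]) ∈ {x : 𝒪[K] ⧸ 𝓂[K] ^ (2 * b) | ∃ u : 𝒪[K], Ideal.Quotient.mk (𝓂[K] ^ (2 * b)) u = x ∧
        Valued.v ((u : K) * σ u - r) ≤ Valued.v (ϖ ^ (2 * b))} ↔
      x ∈ {x : 𝒪[K] ⧸ 𝓂[K] ^ (2 * b) | ∃ u : 𝒪[K], Ideal.Quotient.mk (𝓂[K] ^ (2 * b)) u = x ∧ Valued.v ((u : K) * σ u - r) ≤ Valued.v (ϖ ^ (2 * b))} := by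
  have hwinv1 : Valued.v ((↑(w⁻¹ : (𝒪[K])ˣ) : 𝒪[K]) : K) = 1 := by
    have h1 : ((↑(w⁻¹ : (𝒪[K])ˣ) : 𝒪[K]) : K) * ((w : 𝒪[K]) : K) = 1 := by rw [← Subring.coe_mul, Units.inv_mul, Subring.coe_one]
    have := congrArg Valued.v h1; rw [map_mul, hw1, mul_one, map_one] at this; exact this
  have hσwinv1 : Valued.v (σ (((↑(w⁻¹ : (𝒪[K])ˣ) : 𝒪[K]) : K))) = 1 := by
    have h1 : σ (((↑(w⁻¹ : (𝒪[K])ˣ) : 𝒪[K]) : K)) * σ ((w : 𝒪[K]) : K) = 1 := by rw [← map_mul, ← Subring.coe_mul, Units.inv_mul, Subring.coe_one, map_one]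
    have := congrArg Valued.v h1; rw [map_mul, hσw1, mul_one, map_one] at this; exact this
  simp only [Set.mem_setOf_eq]
  constructor
  · rintro ⟨u, hu, hur⟩
    refine ⟨u * (↑(w⁻¹ : (𝒪[K])ˣ) : 𝒪[K]), ?_, ?_⟩
    · rw [map_mul, hu, mul_assoc, ← map_mul, ← Units.val_mul, mul_inv_cancel, Units.val_one, map_one, mul_one]
    · rw [Subring.coe_mul]
      exact v_mul_norm_sub_le σ hwinv1 hσwinv1 hur (v_inv_norm_mul_sub_le σ w hw1 hσw1 hz)
  · rintro ⟨u, hu, hur⟩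
    refine ⟨u * (w : 𝒪[K]), by rw [map_mul, hu], ?_⟩
    rw [Subring.coe_mul]
    exact v_mul_norm_sub_le σ hw1 hσw1 hur hz

/-- **(M4) BALANCE OF A TUBE-CELL FIBRE FROM A LABEL-REVERSING FIBRE SYMMETRY.**  For a unit `w` as above (fibre-preserving) and a label on `𝒪[K] ⧸ 𝓂[K]^{2b}` with
`lab (x·mk w) ↔ ¬ lab x` on `Sol_{2b}(r)`: `#{x ∈ Sol_{2b}(r) ∣ lab x} = #{x ∈ Sol_{2b}(r) ∣ ¬ lab x}` (no finiteness needed).  By ★ p860795 an EXACT norm-one `w` never satisfies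
`hrev`; the candidate is the non-trivial class of `Sol_{2b}(1)∕E¹`. [cite: Rogawski1990, §4.9 Prop. 4.9.1 (b) p. 55] [cite: Jacobowitz1962, §4] -/
theorem ncard_normFibre_sep_eq_of_mul_labelReversing (σ : K →+* K) {ϖ : K} (b : ℕ) (r : K) (w : (𝒪[K])ˣ) (hw1 : Valued.v ((w : 𝒪[K]) : K) = 1)
    (hσw1 : Valued.v (σ ((w : 𝒪[K]) : K)) = 1) (hz : Valued.v (((w : 𝒪[K]) : K) * σ ((w : 𝒪[K]) : K) * r - r) ≤ Valued.v (ϖ ^ (2 * b)))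
    (lab : 𝒪[K] ⧸ 𝓂[K] ^ (2 * b) → Prop)
    (hrev : ∀ x ∈ {x : 𝒪[K] ⧸ 𝓂[K] ^ (2 * b) | ∃ u : 𝒪[K], Ideal.Quotient.mk (𝓂[K] ^ (2 * b)) u = x ∧ Valued.v ((u : K) * σ u - r) ≤ Valued.v (ϖ ^ (2 * b))},
      lab (x * Ideal.Quotient.mk (𝓂[K] ^ (2 * b)) (w : 𝒪[K])) ↔ ¬ lab x) :
    {x ∈ {x : 𝒪[K] ⧸ 𝓂[K] ^ (2 * b) | ∃ u : 𝒪[K], Ideal.Quotient.mk (𝓂[K] ^ (2 * b)) u = x ∧ Valued.v ((u : K) * σ u - r) ≤ Valued.v (ϖ ^ (2 * b))} | lab x}.ncard =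
      {x ∈ {x : 𝒪[K] ⧸ 𝓂[K] ^ (2 * b) | ∃ u : 𝒪[K], Ideal.Quotient.mk (𝓂[K] ^ (2 * b)) u = x ∧ Valued.v ((u : K) * σ u - r) ≤ Valued.v (ϖ ^ (2 * b))} | ¬ lab x}.ncard :=
  ncard_sep_eq_ncard_sep_not_of_labelReversing _ (Units.map (Ideal.Quotient.mk (𝓂[K] ^ (2 * b))).toMonoidHom w).mulRight
    (fun x => mul_mk_mem_normFibre_iff σ b r w hw1 hσw1 hz x) lab hrev

/-- **(M4) TWO-LABEL BALANCE OF A TUBE-CELL FIBRE** (`P x → Q (x·w)` and `Q x → P (x·w⁻¹)` on `Sol_{2b}(r)` ⇒ `#{P} = #{Q}`; for (β₂-H): `P = +`, `Q = −′`).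
[cite: Rogawski1990, §4.9 Prop. 4.9.1 (b) p. 55] [cite: Jacobowitz1962, §4] -/
theorem ncard_normFibre_sep_eq_of_mul_exchange (σ : K →+* K) {ϖ : K} (b : ℕ) (r : K) (w : (𝒪[K])ˣ) (hw1 : Valued.v ((w : 𝒪[K]) : K) = 1)
    (hσw1 : Valued.v (σ ((w : 𝒪[K]) : K)) = 1) (hz : Valued.v (((w : 𝒪[K]) : K) * σ ((w : 𝒪[K]) : K) * r - r) ≤ Valued.v (ϖ ^ (2 * b)))
    (P Q : 𝒪[K] ⧸ 𝓂[K] ^ (2 * b) → Prop)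
    (hPQ : ∀ x ∈ {x : 𝒪[K] ⧸ 𝓂[K] ^ (2 * b) | ∃ u : 𝒪[K], Ideal.Quotient.mk (𝓂[K] ^ (2 * b)) u = x ∧ Valued.v ((u : K) * σ u - r) ≤ Valued.v (ϖ ^ (2 * b))},
      P x → Q (x * Ideal.Quotient.mk (𝓂[K] ^ (2 * b)) (w : 𝒪[K])))
    (hQP : ∀ x ∈ {x : 𝒪[K] ⧸ 𝓂[K] ^ (2 * b) | ∃ u : 𝒪[K], Ideal.Quotient.mk (𝓂[K] ^ (2 * b)) u = x ∧ Valued.v ((u : K) * σ u - r) ≤ Valued.v (ϖ ^ (2 * b))},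
      Q x → P (x * Ideal.Quotient.mk (𝓂[K] ^ (2 * b)) (↑(w⁻¹ : (𝒪[K])ˣ) : 𝒪[K]))) :
    {x ∈ {x : 𝒪[K] ⧸ 𝓂[K] ^ (2 * b) | ∃ u : 𝒪[K], Ideal.Quotient.mk (𝓂[K] ^ (2 * b)) u = x ∧ Valued.v ((u : K) * σ u - r) ≤ Valued.v (ϖ ^ (2 * b))} | P x}.ncard =
      {x ∈ {x : 𝒪[K] ⧸ 𝓂[K] ^ (2 * b) | ∃ u : 𝒪[K], Ideal.Quotient.mk (𝓂[K] ^ (2 * b)) u = x ∧ Valued.v ((u : K) * σ u - r) ≤ Valued.v (ϖ ^ (2 * b))} | Q x}.ncard :=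
  ncard_sep_eq_ncard_sep_of_equiv _ (Units.map (Ideal.Quotient.mk (𝓂[K] ^ (2 * b))).toMonoidHom w).mulRight
    (fun x => mul_mk_mem_normFibre_iff σ b r w hw1 hσw1 hz x) P Q hPQ hQP

end Fibre

/-! ## §3 ED. 2 (append-only): the ORDER-UNIT form — `Λ ↦ ε • Λ` with `ε·Θε = ν`, `ν` a unit of the ORDER `𝒪_j`, `ρν = ν` NOT assumed
(the cell-preservation half for the (M4-hi) near-similitude torus flips of F0P3-p01 (g36) TORUS-FLIP ∕ LH4-p16 (g0) SIG-FaceTube, whose `Θ`-norm lies in `F` only modulo deep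
units; §1 used only `IsOrd (ϖE^j) (ν·y) ↔ IsOrd (ϖE^j) y`, which holds as soon as `|ν − ρν| ≤ |ϖE^j·(α − ρα)|`; populatedness and label transport of such `ε` are NOT claimed) -/
section OrderUnit

variable {K : Type*} [Field K] [Valued K ℤᵐ⁰] {ρ Θ : K →+* K} {α : K}

/-- **A UNIT CONGRUENT TO ITS CONJUGATE MODULO THE CONDUCTOR IS AN ORDER UNIT**: `|ν| = 1`, `|ν − ρν| ≤ |c·(α − ρα)|` ⟹ `IsOrd ρ α c (ν·y) ↔ IsOrd ρ α c y` for every `y`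
(`νy − ρ(νy) = ν(y − ρy) + (ν − ρν)·ρy`; the converse through `ν⁻¹`, which satisfies the same letters; `ρ` isometric). [cite: Serre1979, Ch. III §6 Prop. 12] -/
theorem isOrd_mul_iff_of_v_sub_map_le (hvρ : ∀ x, Valued.v (ρ x) = Valued.v x) {ν c : K} (hν1 : Valued.v ν = 1)
    (hνρ : Valued.v (ν - ρ ν) ≤ Valued.v (c * (α - ρ α))) (y : K) : IsOrd ρ α c (ν * y) ↔ IsOrd ρ α c y := by
  have hν0 : ν ≠ 0 := fun h0 => by rw [h0, map_zero] at hν1; exact zero_ne_one hν1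
  -- one direction for any unit `ν'` with the two letters
  have key : ∀ {ν' : K}, Valued.v ν' = 1 → Valued.v (ν' - ρ ν') ≤ Valued.v (c * (α - ρ α)) → ∀ y, IsOrd ρ α c y → IsOrd ρ α c (ν' * y) := by
    intro ν' hν'1 hν'ρ y hy
    rw [isOrd_iff] at hy ⊢
    refine ⟨by rw [map_mul, hν'1, one_mul]; exact hy.1, ?_⟩
    rw [show ν' * y - ρ (ν' * y) = ν' * (y - ρ y) + (ν' - ρ ν') * ρ y by rw [map_mul]; ring]
    refine Valuation.map_add_le _ ?_ ?_
    · rw [map_mul, hν'1, one_mul]; exact hy.2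
    · rw [map_mul, hvρ]; exact (mul_le_of_le_one_right zero_le hy.1).trans hν'ρ
  refine ⟨fun h => ?_, key hν1 hνρ y⟩
  have hinv1 : Valued.v ν⁻¹ = 1 := by rw [map_inv₀, hν1, inv_one]
  have hinvρ : Valued.v (ν⁻¹ - ρ ν⁻¹) ≤ Valued.v (c * (α - ρ α)) := by
    rw [map_inv₀, show ν⁻¹ - (ρ ν)⁻¹ = -(ν⁻¹ * (ρ ν)⁻¹ * (ν - ρ ν)) by field_simp [(map_ne_zero ρ).2 hν0]; ring, Valuation.map_neg,
      map_mul, map_mul, map_inv₀, map_inv₀, hν1, hvρ, hν1, inv_one, one_mul, one_mul]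
    exact hνρ
  have := key hinv1 hinvρ (ν * y) h
  rwa [inv_mul_cancel_left₀ hν0] at this

/-- **`Λ ↦ ε • Λ` PRESERVES `levelSet ρ Θ α ϖE h j a` FOR AN ORDER-UNIT MULTIPLIER** (`ε·Θε = ν`, `|ν| = 1`, `ν·𝒪_j = 𝒪_j` as the letter
`hνO : ∀ y, IsOrd ρ α (ϖE^j) (ν·y) ↔ IsOrd ρ α (ϖE^j) y`; `ρν = ν` NOT assumed). [cite: Jacobowitz1962, §4] [cite: Serre1979, Ch. III §6 Prop. 12] -/
theorem smul_mem_levelSet_iff_of_orderUnit {ε ν : K} (hε : ε * Θ ε = ν) (hν1 : Valued.v ν = 1) (ϖE h : K) (j a : ℕ)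
    (hνO : ∀ y, IsOrd ρ α (ϖE ^ j) (ν * y) ↔ IsOrd ρ α (ϖE ^ j) y) (Λ : AddSubgroup K) :
    ε • Λ ∈ levelSet ρ Θ α ϖE h j a ↔ Λ ∈ levelSet ρ Θ α ϖE h j a := by
  have hν0 : ν ≠ 0 := fun h0 => by rw [h0, map_zero] at hν1; exact zero_ne_one hν1
  have hε0 : ε ≠ 0 := ne_zero_of_mul_map_eq hε hν0
  -- one direction for any `(ε', ν')` with the letters
  have key : ∀ {ε' ν' : K}, ε' * Θ ε' = ν' → Valued.v ν' = 1 → (∀ y, IsOrd ρ α (ϖE ^ j) (ν' * y) ↔ IsOrd ρ α (ϖE ^ j) y) →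
      ∀ {Λ' : AddSubgroup K}, Λ' ∈ levelSet ρ Θ α ϖE h j a → ε' • Λ' ∈ levelSet ρ Θ α ϖE h j a := by
    intro ε' ν' hε' hν'1 hν'O Λ' hΛ'
    have hν'0 : ν' ≠ 0 := fun h0 => by rw [h0, map_zero] at hν'1; exact zero_ne_one hν'1
    have hε'0 : ε' ≠ 0 := ne_zero_of_mul_map_eq hε' hν'0
    obtain ⟨x₀, hx₀, hmem, hyO, hyprim, hylev⟩ := hΛ'
    refine ⟨ε' * x₀, mul_ne_zero hε'0 hx₀, fun x => ?_, ?_, ?_, ?_⟩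
    · rw [AddSubgroup.mem_smul_pointwise_iff_exists]
      constructor
      · rintro ⟨s, hs, rfl⟩
        obtain ⟨z, hz, rfl⟩ := (hmem s).1 hs
        exact ⟨z, hz, by rw [smul_eq_mul, mul_assoc]⟩
      · rintro ⟨z, hz, rfl⟩
        exact ⟨x₀ * z, (hmem _).2 ⟨z, hz, rfl⟩, by rw [smul_eq_mul, mul_assoc]⟩
    · rw [dualGen_mul_left, hε', hν'O]; exact hyO
    · rw [dualGen_mul_left, hε', mul_div_assoc, hν'O]; exact hyprim
    · rw [dualGen_mul_left, hε', map_mul, hν'1, one_mul, hylev]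
  refine ⟨fun hΛ => ?_, key hε hν1 hνO⟩
  have hinvO : ∀ y, IsOrd ρ α (ϖE ^ j) (ν⁻¹ * y) ↔ IsOrd ρ α (ϖE ^ j) y := fun y => by
    have := hνO (ν⁻¹ * y); rw [mul_inv_cancel_left₀ hν0] at this; exact this.symm
  have h' := key (inv_mul_map_inv_eq hε) (by rw [map_inv₀, hν1, inv_one]) hinvO hΛ
  rwa [smul_smul, inv_mul_cancel₀ hε0, one_smul] at h'

/-- **A level-set member is stable under an order unit: `ν • Λ = Λ`** (`|ν| = 1`, `hνO`). [cite: Serre1979, Ch. III §6 Prop. 12] -/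
theorem smul_eq_self_of_orderUnit_of_mem_levelSet {ν : K} (hν1 : Valued.v ν = 1) {ϖE h : K} {j a : ℕ}
    (hνO : ∀ y, IsOrd ρ α (ϖE ^ j) (ν * y) ↔ IsOrd ρ α (ϖE ^ j) y) {Λ : AddSubgroup K} (hΛ : Λ ∈ levelSet ρ Θ α ϖE h j a) : ν • Λ = Λ := by
  have hν0 : ν ≠ 0 := fun h0 => by rw [h0, map_zero] at hν1; exact zero_ne_one hν1
  obtain ⟨x₀, -, hmem, -, -, -⟩ := hΛ
  ext x
  rw [AddSubgroup.mem_smul_pointwise_iff_exists]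
  constructor
  · rintro ⟨s, hs, rfl⟩
    obtain ⟨z, hz, rfl⟩ := (hmem s).1 hs
    refine (hmem _).2 ⟨ν * z, (hνO z).2 hz, ?_⟩
    rw [smul_eq_mul]; ring
  · intro hx
    obtain ⟨z, hz, rfl⟩ := (hmem x).1 hx
    have hz' : IsOrd ρ α (ϖE ^ j) (ν⁻¹ * z) := by
      have := hνO (ν⁻¹ * z); rw [mul_inv_cancel_left₀ hν0] at this; exact this.1 hz
    refine ⟨x₀ * (ν⁻¹ * z), (hmem _).2 ⟨ν⁻¹ * z, hz', rfl⟩, ?_⟩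
    rw [smul_eq_mul, ← mul_assoc, mul_comm ν x₀, mul_assoc, mul_inv_cancel_left₀ hν0]

/-- **`Λ ↦ ε • Λ` PRESERVES `levelSetDep ρ Θ α ϖE h j a μ` FOR AN ORDER-UNIT MULTIPLIER** (`ε·Θε = ν`, `|ν| = 1`, `hνO`; iff).  This is the cell-preservation half for the
near-similitude torus flips of (M4-hi) (`ν ∉ F`); their populatedness and label transport are NOT claimed here. [cite: Jacobowitz1962, §4] [cite: Kottwitz1986BaseChangeUnits, §1 pp. 240–241] -/
theorem smul_mem_levelSetDep_iff_of_orderUnit {ε ν : K} (hε : ε * Θ ε = ν) (hν1 : Valued.v ν = 1) (ϖE h : K) (j a : ℕ) (μ : K)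
    (hνO : ∀ y, IsOrd ρ α (ϖE ^ j) (ν * y) ↔ IsOrd ρ α (ϖE ^ j) y) (Λ : AddSubgroup K) :
    ε • Λ ∈ levelSetDep ρ Θ α ϖE h j a μ ↔ Λ ∈ levelSetDep ρ Θ α ϖE h j a μ := by
  have hν0 : ν ≠ 0 := fun h0 => by rw [h0, map_zero] at hν1; exact zero_ne_one hν1
  have hε0 : ε ≠ 0 := ne_zero_of_mul_map_eq hε hν0
  have key : ∀ {ε' ν' : K}, ε' * Θ ε' = ν' → Valued.v ν' = 1 → (∀ y, IsOrd ρ α (ϖE ^ j) (ν' * y) ↔ IsOrd ρ α (ϖE ^ j) y) →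
      ∀ {Λ' : AddSubgroup K}, Λ' ∈ levelSetDep ρ Θ α ϖE h j a μ → ε' • Λ' ∈ levelSetDep ρ Θ α ϖE h j a μ := by
    intro ε' ν' hε' hν'1 hν'O Λ' hΛ'
    have hν'0 : ν' ≠ 0 := fun h0 => by rw [h0, map_zero] at hν'1; exact zero_ne_one hν'1
    have hεΛ : ε' • Λ' ∈ levelSet ρ Θ α ϖE h j a := (smul_mem_levelSet_iff_of_orderUnit hε' hν'1 ϖE h j a hν'O Λ').2 hΛ'.1
    refine ⟨hεΛ, fun b hb => ?_⟩
    have hb' : ∀ x ∈ Λ', Valued.v (h * Θ x * (Θ ε' * b) + ρ (h * Θ x * (Θ ε' * b))) ≤ 1 := fun x hx => by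
      have hx' := hb (ε' • x) (AddSubgroup.smul_mem_pointwise_smul x ε' Λ' hx)
      rwa [smul_eq_mul, map_mul, show h * (Θ ε' * Θ x) * b = h * Θ x * (Θ ε' * b) by ring] at hx'
    have hμ : μ * (Θ ε' * b) ∈ Λ' := hΛ'.2 (Θ ε' * b) hb'
    have hεμ : ε' • (μ * (Θ ε' * b)) = ν' * (μ * b) := by
      rw [smul_eq_mul, show ε' * (μ * (Θ ε' * b)) = (ε' * Θ ε') * (μ * b) by ring, hε']
    have hνμb : ν' * (μ * b) ∈ ε' • Λ' := by rw [← hεμ]; exact AddSubgroup.smul_mem_pointwise_smul _ ε' Λ' hμ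
    have hinvO : ∀ y, IsOrd ρ α (ϖE ^ j) (ν'⁻¹ * y) ↔ IsOrd ρ α (ϖE ^ j) y := fun y => by
      have := hν'O (ν'⁻¹ * y); rw [mul_inv_cancel_left₀ hν'0] at this; exact this.symm
    have hstab : ν'⁻¹ • (ε' • Λ') = ε' • Λ' :=
      smul_eq_self_of_orderUnit_of_mem_levelSet (ρ := ρ) (Θ := Θ) (α := α) (by rw [map_inv₀, hν'1, inv_one]) hinvO hεΛ
    have : ν'⁻¹ • (ν' * (μ * b)) ∈ ν'⁻¹ • (ε' • Λ') := AddSubgroup.smul_mem_pointwise_smul _ ν'⁻¹ _ hνμb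
    rwa [hstab, smul_eq_mul, inv_mul_cancel_left₀ hν'0] at this
  refine ⟨fun hΛ => ?_, key hε hν1 hνO⟩
  have hinvO : ∀ y, IsOrd ρ α (ϖE ^ j) (ν⁻¹ * y) ↔ IsOrd ρ α (ϖE ^ j) y := fun y => by
    have := hνO (ν⁻¹ * y); rw [mul_inv_cancel_left₀ hν0] at this; exact this.symm
  have h' := key (inv_mul_map_inv_eq hε) (by rw [map_inv₀, hν1, inv_one]) hinvO hΛ
  rwa [smul_smul, inv_mul_cancel₀ hε0, one_smul] at h'

/-- **TWO-LABEL BALANCE OF A DEPTH CELL UNDER AN ORDER-UNIT FLIP** (`P Λ → Q (ε • Λ)`, `Q Λ → P (ε⁻¹ • Λ)` on the cell ⇒ `#{P} = #{Q}`) — the socket for the (M4-hi)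
near-similitude flips once their label ∕ populatedness transport is known. [cite: Rogawski1990, §4.9 Prop. 4.9.1 (b) p. 55] [cite: Kottwitz1986BaseChangeUnits, §1 pp. 240–241] -/
theorem ncard_levelSetDep_sep_eq_of_orderUnit_exchange {ε ν : K} (hε : ε * Θ ε = ν) (hν1 : Valued.v ν = 1) (ϖE h : K) (j a : ℕ) (μ : K)
    (hνO : ∀ y, IsOrd ρ α (ϖE ^ j) (ν * y) ↔ IsOrd ρ α (ϖE ^ j) y) (P Q : AddSubgroup K → Prop)
    (hPQ : ∀ Λ ∈ levelSetDep ρ Θ α ϖE h j a μ, P Λ → Q (ε • Λ)) (hQP : ∀ Λ ∈ levelSetDep ρ Θ α ϖE h j a μ, Q Λ → P (ε⁻¹ • Λ)) :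
    {Λ ∈ levelSetDep ρ Θ α ϖE h j a μ | P Λ}.ncard = {Λ ∈ levelSetDep ρ Θ α ϖE h j a μ | Q Λ}.ncard := by
  have hν0 : ν ≠ 0 := fun h0 => by rw [h0, map_zero] at hν1; exact zero_ne_one hν1
  have hε0 : ε ≠ 0 := ne_zero_of_mul_map_eq hε hν0
  let τ : AddSubgroup K ≃ AddSubgroup K :=
    ⟨fun Λ => ε • Λ, fun Λ => ε⁻¹ • Λ, fun Λ => by simp only [smul_smul, inv_mul_cancel₀ hε0, one_smul],
      fun Λ => by simp only [smul_smul, mul_inv_cancel₀ hε0, one_smul]⟩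
  exact ncard_sep_eq_ncard_sep_of_equiv _ τ (fun Λ => smul_mem_levelSetDep_iff_of_orderUnit hε hν1 ϖE h j a μ hνO Λ) P Q hPQ hQP

end OrderUnit
end Summit.HodgeConjecture.HodgeConjecture.Cruxes.H413.F0P3cDyRamConeCellFlipBalance
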